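import Mathlib
import Summits.Langlands.Langlands.Theses.PrimitiveRankLadder

/-! # PrimitiveRankLadder — proof of the glue item of the split of `RankTwoPrimitiveAutomorphy` (stmt-Langlands-24803) into
`GenericEllipticAutomorphy ∧ ExceptionalEllipticAutomorphy ∧ NonEllipticRankTwoAutomorphy` (lens-5-g5 node `SwitchingEngineSplit`).
Pure logic: excluded middle on the two nested ∃-dials («has a totally real elliptic witness» ⊇ «has a 3–5–7-generic one»), written by
`by_contra` so that the dials are NEVER restated (robust to the gate's rendering).  To land as
`Summits/Langlands/Langlands/Theorems/PrimitiveRankLadderRankTwoPrimitiveAutomorphyOfSplit.lean` once the edit has created the glue item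
`PrimitiveRankLadder.RankTwoPrimitiveAutomorphy_of_split : Prop := GenericEllipticAutomorphy → ExceptionalEllipticAutomorphy →
NonEllipticRankTwoAutomorphy → RankTwoPrimitiveAutomorphy`. -/

set_option linter.dupNamespace false

namespace Summit.Langlands.Langlands.Theorems

open Summit.Langlands.Langlands.Theses

/-- GEN → EXC → REST → R2. -/
theorem RankTwoPrimitiveAutomorphy_of_split_proof : PrimitiveRankLadder.RankTwoPrimitiveAutomorphy_of_split := by
  intro hG hE hR K _ _ hcpt ℓ _ ι ρ hirr hgeo htw
  by_contra hno
  refine hno (hR K hcpt ℓ ι ρ hirr hgeo htw fun hw => ?_)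
  refine hno (hE K hcpt ℓ ι ρ hirr hgeo htw ⟨hw, fun hg => ?_⟩)
  exact hno (hG K hcpt ℓ ι ρ hirr hgeo htw hg)

end Summit.Langlands.Langlands.Theorems
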